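import Summits.HodgeConjecture.HodgeConjecture.Theorems.Ring2WeilCoverageCMFieldRationalClassesDFourDyadic
import Summits.HodgeConjecture.HodgeConjecture.Theorems.Ring2WeilCoverageCMFieldRationalClassesProducts
import HarnessLib

/-!
# Ring 2 — Weil-family coverage, CM-field rows: the SQUAREFREE RATIONAL ROWS of the non-Galois table `E = ℚ(√-(3+√2))`
  ASSEMBLED prime by prime (WEIL-FAMILY-COVERAGE «## b03», cell (xvi′), assembly; part 59)

research route conditional on HC_CM; not a corollary; Q11.4-sentence-2 already refuted in dim ≥ 3.

Carrier `R = S² + 6S + 7` (`F = ℚ(√2)`, `v₂ = (√2)`, `𝔭_θ = (7, θ)`; rows `T(t) = {𝔭 : (t, θ)_𝔭 = -1}`) [cite: Deligne1982HodgeCycles, §4 (1)].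
For ANY finite set `P` of primes and `n = ∏_{ℓ ∈ P} ℓ`:

* §169 the rows `T(ℓ)` of distinct primes are DISJOINT outside `Z = {v₂, 𝔭_θ}` (a bad place `u ∌ θ` contains its prime — part 55), hence
  by part 58's assembly principle **`T(n) ∖ {v₂, 𝔭_θ} = ⋃_{ℓ ∈ P} (T(ℓ) ∖ {v₂, 𝔭_θ})`**;
* §170 inside `Z`: **`v₂ ∈ T(n) ⟺ #{ℓ ∈ P : ℓ ≡ 3 (mod 4)}` odd** (part 55) and **`𝔭_θ ∈ T(n) ⟺ #{ℓ ∈ P : ℓ ≡ 3, 5, 6 (mod 7) ∨ ℓ = 7}` odd**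
  (part 54) — so every squarefree rational row is read off the prime rows of part 56, and conversely every even finite set of
  places made of whole «prime pieces» `T(ℓ) ∖ Z` plus the forced parities at `v₂`, `𝔭_θ` is the row of the product of those primes.
No new definition, no named fact, no sorry; nothing about the Hodge conjecture is asserted.
-/

noncomputable section

set_option linter.dupNamespace false

open Polynomial NumberField IsDedekindDomain

namespace Summit.HodgeConjecture.HodgeConjecture.Ring2.WeilCoverageCM

open Literature.AlgebraicGeometry.Deligne1982
open Literature.NumberTheory.QuadraticForms

variable {R : Polynomial ℤ} [Fact (Irreducible (cmPolyQ R))] [Fact (Irreducible (realPolyQ R))]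

section DFourAssembly

/-! ### §169 Prime rows are disjoint outside `{v₂, 𝔭_θ}`; the squarefree rows assembled -/

/-- `ℚ(√-(3+√2))`: **the rows of two DISTINCT primes are disjoint outside `{v₂, 𝔭_θ}`** (a common bad place `u ∉ {v₂, 𝔭_θ}` would be an
odd place `u ∌ θ` containing both primes). [cite: Omeara1963, §63B Example 63:12] [cite: Deligne1982HodgeCycles, §4 (1)] -/
theorem dFour_badPlaces_natCast_disjoint_off (hR : R = X ^ 2 + C 6 * X + C 7) {θₒ : 𝓞 (realField R)}
    (hθ : (θₒ : realField R) = AdjoinRoot.root (realPolyQ R)) (v₂ : HeightOneSpectrum (𝓞 (realField R)))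
    (h2 : (2 : 𝓞 (realField R)) ∈ v₂.asIdeal) (w : HeightOneSpectrum (𝓞 (realField R)))
    (h7w : ((7 : ℕ) : 𝓞 (realField R)) ∈ w.asIdeal) (hθw : θₒ ∈ w.asIdeal) {ℓ ℓ' : ℕ} (hℓ : ℓ.Prime) (hℓ' : ℓ'.Prime)
    (hne : ℓ ≠ ℓ') {y : HeightOneSpectrum (𝓞 (realField R)) ⊕ InfinitePlace (realField R)}
    (hyZ : y ∉ ({Sum.inl v₂, Sum.inl w} : Set _)) (hy : y ∈ badPlaces (ℓ : realField R) (AdjoinRoot.root (realPolyQ R))) :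
    y ∉ badPlaces (ℓ' : realField R) (AdjoinRoot.root (realPolyQ R)) := by
  intro hy'
  have hyv : y ≠ Sum.inl v₂ := fun h ↦ hyZ (by rw [h]; exact Set.mem_insert _ _)
  obtain ⟨u, rfl, h2u, -, hu⟩ := dFour_exists_of_mem_badPlaces_natCast_diff_dyadic hR hθ v₂ h2 w h7w hθw hℓ ⟨hy, hyv⟩
  rcases hu with huw | ⟨hθu, hℓu⟩
  · exact hyZ (by rw [huw]; exact Set.mem_insert_of_mem _ (Set.mem_singleton _))
  · exact hne (prime_natCast_mem_unique hℓ hℓ' u hℓu (dFour_natCast_mem_of_inl_mem_badPlaces hθ u h2u hθu hℓ' hy'))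

open scoped Classical in
/-- **`ℚ(√-(3+√2))` — THE SQUAREFREE ROWS ASSEMBLED**: for any finite set `P` of primes, **`T(∏_{ℓ ∈ P} ℓ) ∖ {v₂, 𝔭_θ} =
⋃_{ℓ ∈ P} (T(ℓ) ∖ {v₂, 𝔭_θ})`** (part 58's assembly principle; the prime pieces `T(ℓ) ∖ {v₂, 𝔭_θ}` are listed in part 56: `∅`,
`{(ℓ)}`, `{v}`, `{v, v'}`). [cite: Omeara1963, §63B] [cite: Deligne1982HodgeCycles, §4 (1)] -/
theorem dFour_badPlaces_prod_primes_diff (hR : R = X ^ 2 + C 6 * X + C 7) {θₒ : 𝓞 (realField R)}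
    (hθ : (θₒ : realField R) = AdjoinRoot.root (realPolyQ R)) (v₂ : HeightOneSpectrum (𝓞 (realField R)))
    (h2 : (2 : 𝓞 (realField R)) ∈ v₂.asIdeal) (w : HeightOneSpectrum (𝓞 (realField R)))
    (h7w : ((7 : ℕ) : 𝓞 (realField R)) ∈ w.asIdeal) (hθw : θₒ ∈ w.asIdeal) (P : Finset ℕ) (hP : ∀ ℓ ∈ P, ℓ.Prime) :
    badPlaces ((∏ ℓ ∈ P, ℓ : ℕ) : realField R) (AdjoinRoot.root (realPolyQ R)) \ {Sum.inl v₂, Sum.inl w} =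
      ⋃ ℓ ∈ P, (badPlaces (ℓ : realField R) (AdjoinRoot.root (realPolyQ R)) \ {Sum.inl v₂, Sum.inl w}) := by
  rw [Nat.cast_prod]
  exact badPlaces_prod_diff_eq_biUnion_of_disjoint P (fun ℓ ↦ (ℓ : realField R))
    (fun ℓ hℓ ↦ by exact_mod_cast (hP ℓ hℓ).ne_zero) _
    (fun ℓ hℓ ℓ' hℓ' hne y hyZ hy ↦ dFour_badPlaces_natCast_disjoint_off hR hθ v₂ h2 w h7w hθw (hP ℓ hℓ) (hP ℓ' hℓ') hne hyZ hy)

/-! ### §170 Inside `{v₂, 𝔭_θ}`: the parities -/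

open scoped Classical in
/-- **`v₂ ∈ T(∏_{ℓ ∈ P} ℓ) ⟺ #{ℓ ∈ P : ℓ ≡ 3 (mod 4)}` is odd** (parts 55, 58). [cite: Omeara1963, §63B and §71D Thm. 71:18]
[cite: Deligne1982HodgeCycles, §4 (1)] -/
theorem dFour_inl_dyadic_mem_badPlaces_prod_primes_iff (hR : R = X ^ 2 + C 6 * X + C 7)
    (v₂ : HeightOneSpectrum (𝓞 (realField R))) (h2 : (2 : 𝓞 (realField R)) ∈ v₂.asIdeal) (P : Finset ℕ)
    (hP : ∀ ℓ ∈ P, ℓ.Prime) :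
    Sum.inl v₂ ∈ badPlaces ((∏ ℓ ∈ P, ℓ : ℕ) : realField R) (AdjoinRoot.root (realPolyQ R)) ↔
      Odd (P.filter fun ℓ ↦ ℓ % 4 = 3).card := by
  rw [mem_badPlaces_natCast_prod_iff_odd_card P (fun ℓ ↦ ℓ) (fun ℓ hℓ ↦ (hP ℓ hℓ).ne_zero)]
  rw [Finset.filter_congr fun ℓ hℓ ↦ dFour_inl_mem_badPlaces_natCast_iff_of_mem_two hR v₂ h2 (hP ℓ hℓ)]

open scoped Classical in
/-- **`𝔭_θ ∈ T(∏_{ℓ ∈ P} ℓ) ⟺ #{ℓ ∈ P : ℓ ≡ 3, 5, 6 (mod 7) ∨ ℓ = 7}` is odd** (parts 54, 58). [cite: Omeara1963, §63B Cor. 63:11a]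
[cite: Deligne1982HodgeCycles, §4 (1)] -/
theorem dFour_inl_root_mem_badPlaces_prod_primes_iff (hR : R = X ^ 2 + C 6 * X + C 7) {θₒ : 𝓞 (realField R)}
    (hθ : (θₒ : realField R) = AdjoinRoot.root (realPolyQ R)) (w : HeightOneSpectrum (𝓞 (realField R)))
    (h7w : ((7 : ℕ) : 𝓞 (realField R)) ∈ w.asIdeal) (hθw : θₒ ∈ w.asIdeal) (P : Finset ℕ) (hP : ∀ ℓ ∈ P, ℓ.Prime) :
    Sum.inl w ∈ badPlaces ((∏ ℓ ∈ P, ℓ : ℕ) : realField R) (AdjoinRoot.root (realPolyQ R)) ↔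
      Odd (P.filter fun ℓ ↦ (ℓ % 7 = 3 ∨ ℓ % 7 = 5 ∨ ℓ % 7 = 6) ∨ ℓ = 7).card := by
  rw [mem_badPlaces_natCast_prod_iff_odd_card P (fun ℓ ↦ ℓ) (fun ℓ hℓ ↦ (hP ℓ hℓ).ne_zero)]
  rw [Finset.filter_congr fun ℓ hℓ ↦ dFour_inl_mem_badPlaces_natCast_iff_of_root_mem hR hθ w h7w hθw (hP ℓ hℓ)]

open scoped Classical in
/-- **Every place of a squarefree rational row**: for `n = ∏_{ℓ ∈ P} ℓ`, `x ∈ T(n)` iff `x = v₂` with `#{ℓ ∈ P : ℓ ≡ 3 (4)}` odd, or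
`x = 𝔭_θ` with `#{ℓ ∈ P : (ℓ|7) = -1 ∨ ℓ = 7}` odd, or `x ∉ {v₂, 𝔭_θ}` lies in `T(ℓ)` for some (then exactly one) `ℓ ∈ P`.
[cite: Omeara1963, §63B] [cite: Deligne1982HodgeCycles, §4 (1)] -/
theorem dFour_mem_badPlaces_prod_primes_iff (hR : R = X ^ 2 + C 6 * X + C 7) {θₒ : 𝓞 (realField R)}
    (hθ : (θₒ : realField R) = AdjoinRoot.root (realPolyQ R)) (v₂ : HeightOneSpectrum (𝓞 (realField R)))
    (h2 : (2 : 𝓞 (realField R)) ∈ v₂.asIdeal) (w : HeightOneSpectrum (𝓞 (realField R)))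
    (h7w : ((7 : ℕ) : 𝓞 (realField R)) ∈ w.asIdeal) (hθw : θₒ ∈ w.asIdeal) (P : Finset ℕ) (hP : ∀ ℓ ∈ P, ℓ.Prime)
    {x : HeightOneSpectrum (𝓞 (realField R)) ⊕ InfinitePlace (realField R)} (hx : x ∉ ({Sum.inl v₂, Sum.inl w} : Set _)) :
    x ∈ badPlaces ((∏ ℓ ∈ P, ℓ : ℕ) : realField R) (AdjoinRoot.root (realPolyQ R)) ↔
      ∃ ℓ ∈ P, x ∈ badPlaces (ℓ : realField R) (AdjoinRoot.root (realPolyQ R)) := by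
  rw [Nat.cast_prod]
  exact mem_badPlaces_prod_iff_exists_of_disjoint P (fun ℓ ↦ (ℓ : realField R))
    (fun ℓ hℓ ↦ by exact_mod_cast (hP ℓ hℓ).ne_zero) _
    (fun ℓ hℓ ℓ' hℓ' hne y hyZ hy ↦ dFour_badPlaces_natCast_disjoint_off hR hθ v₂ h2 w h7w hθw (hP ℓ hℓ) (hP ℓ' hℓ') hne hyZ hy) hx

end DFourAssembly

end Summit.HodgeConjecture.HodgeConjecture.Ring2.WeilCoverageCM

end
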